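import Mathlib
import HarnessLib
import Summits.HubbardSuperconductivity.HubbardSuperconductivity.Theorems.KLProgrammeKLRegimeVolumeLimitBoundGlueDominated

/-!
# Child `KLRegimeVolumeLimitV12` (stmt-HubbardSuperconductivity-19858), stub `stub_vl_bound` — the TWO-POINT Fourier step (F) and the final glue:
# the per-label two-point input (H2pt) reduced to a POINTWISE identification of the τ-resolved position-space two-point numerator
# (seat hubbard-kl-k3c5-p3, technique «OS-positivity-free direct assembly»)

`…VolumeLimitBoundGlueDominated.stub_vl_bound_of_pointwise_twoPoint` closes the registered stub from (P) (pointwise word six-point limits + sup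
bound) and (H2pt) (per-label limits `σH n p`, `‖σH‖ ≤ BH`, of the bare spin-`↑` carrier).  This module supplies the finite-`M` Fourier step for the
TWO-point numerator (TAU-BRIDGE.md (F), HOME/hubbard-kl-k3c5-p2) and turns (H2pt) into supplier-shaped inputs:
* `§1` `twoPoint_eq_integral_position` — for every `U`, `L`, `M`, `β ≠ 0`:
  `N_M(k,σ) = βL² · ∫₀^β Σ_x e^{−iω_k s} conj χ_{k⃗}(x) · P_M(x,s) ds`,  `P_M(x,s) := ∫dμ_{C_M} ψ⁺_{(x,s)σ}ψ⁻_{(0,0)σ} e^{−V}` (selection rule of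
  `…Occupation` + orthogonality: the momentum two-point numerator is the Fourier coefficient of t2's τ-resolved position two-point numerator);
* `§2` per-label convergence of the carrier from the L¹(ds)-convergence of `P_M(x,·)` and `D_M → D∞` (`tendsto_klSelfEnergy_bare_label`);
* `§3` **`stub_vl_bound_of_pointwise_limits`**: the registered stub text verbatim from, for every `β > 0`, `U`, `μ`, `L ≥ 3`:
  (P6) pointwise limits + sup bound of the word six-point numerator (k3c5-p1's interface), (P2) pointwise limits `P∞ x s` + sup bound of the
  two-point numerator for `s ∈ [0,β)` (k3c5-p2's `tendsto_gaussExpect_twoPoint_mul_grassmannExp_allU_time` / `norm_…_le_allU_time` give exactly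
  this), and (B2) an `L`-uniform bound `‖(J∞(n,p)/D∞ + ĝ)/ĝ²‖ ≤ BH`, `J∞(n,p) = βL²∫₀^βΣ_x e^{−iω_n s}conj χ_p(x)P∞ x s ds` — which is k3c5-p2's
  `‖(ĝ − 𝒢_L)(−ik₀+ξ)²‖ ≤ |U|(2+β|U|)` (`…ThermalGreenHubbardTorusExact`) AS SOON AS `P∞ x s / D∞` is identified pointwise with the Hamiltonian
  τ-two-point function (the one remaining identification, (H) of TAU-BRIDGE, pointwise in `(x,s)`, no Fourier bookkeeping left).
Everything is proved; no definition.
-/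

noncomputable section

namespace Summit.HubbardSuperconductivity.HubbardSuperconductivity.Theorems.TwoPointAssembly

set_option linter.dupNamespace false -- summit = problem name (single-conjunct summit), D-0017

open Finset Filter Topology MeasureTheory intervalIntegral Literature.MathematicalPhysics.QuantumLattice Literature.Probability.LatticeModels
  GrassmannAlgebra
open Summit.HubbardSuperconductivity.HubbardSuperconductivity.Theorems.KLRegimeSplit
open Summit.HubbardSuperconductivity.HubbardSuperconductivity.Theorems.KLProgrammeLegKernels
open scoped ComplexConjugate ComplexOrder

variable {L M : ℕ} [NeZero L]

/-! ## §1 The two-point numerator as a time-integral Fourier coefficient of the position two-point numerator -/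

/-- **The τ-resolved position two-point numerator, expanded**: `∫ψ⁺_{(x,s)σ}ψ⁻_{(0,0)σ}e^{−V} = (βL²)⁻²Σ_q e^{iω_q s}χ_{q⃗}(x)·N(q,σ)`
(selection rule: only diagonal labels survive). -/
theorem positionTwoPoint_eq_sum (β U μ : ℝ) (σ : Fin 2) (x : TorusSite 2 L) (s : ℝ) :
    gaussExpect ℂ (hubbardCovariance L M β μ 0)
        (positionField L M β 0 σ x s * positionField L M β 1 σ 0 0 * grassmannExp (-(hubbardInteraction L M β U))) =
      ∑ q : FreqMomentum L M,
        ((((1 / (β * (L : ℝ) ^ 2) : ℝ) : ℂ) * conj (vertexPlaneWave L M β 0 q x s)) * (((1 / (β * (L : ℝ) ^ 2) : ℝ) : ℂ))) *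
          gaussExpect ℂ (hubbardCovariance L M β μ 0)
            (gen ℂ (((q, σ), 0) : HubbardFieldIdx L M) * gen ℂ (((q, σ), 1) : HubbardFieldIdx L M) *
              grassmannExp (-(hubbardInteraction L M β U))) := by
  rw [positionField_mul_positionField, Finset.sum_mul, map_sum]
  refine Finset.sum_congr rfl fun q _ => ?_
  rw [Finset.sum_mul, map_sum, Finset.sum_eq_single q]
  · rw [smul_mul_assoc, map_smul, smul_eq_mul, vertexPlaneWave_origin, map_one, mul_one]
  · intro q' _ hq'
    rw [smul_mul_assoc, map_smul, (gaussExpect_genPair_boltzmann_eq_zero_of_ne β U μ (p := (q, σ)) (q := (q', σ))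
      (fun h => hq' (Prod.ext_iff.mp h).1.symm)).1, smul_zero]
  · intro h; exact absurd (Finset.mem_univ _) h

/-- One leg phase against `e^{−iω_k s} conj χ_k(x)`: time integral and character sum. -/
theorem integral_sum_phase_pair {β : ℝ} (hβ : β ≠ 0) (k q : FreqMomentum L M) :
    ∫ s in (0 : ℝ)..β, ∑ x : TorusSite 2 L,
        Complex.exp (-(((matsubaraFreq β M k.1 * s : ℝ) : ℂ) * Complex.I)) * conj (torusChar k.2 x) * conj (vertexPlaneWave L M β 0 q x s) =
      (if q.1 = k.1 then (β : ℂ) else 0) * (if q.2 = k.2 then ((L : ℂ) ^ 2) else 0) := by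
  have hterm : ∀ (s : ℝ) (x : TorusSite 2 L),
      Complex.exp (-(((matsubaraFreq β M k.1 * s : ℝ) : ℂ) * Complex.I)) * conj (torusChar k.2 x) * conj (vertexPlaneWave L M β 0 q x s) =
        Complex.exp (((2 * Real.pi * ((matsubaraInt M q.1 - matsubaraInt M k.1 : ℤ) : ℝ) * s / β : ℝ) : ℂ) * Complex.I) *
          torusChar (q.2 - k.2) x := by
    intro s x
    rw [conj_vertexPlaneWave_zero_eq, torusChar_sub_left]
    have hph : Complex.exp (-(((matsubaraFreq β M k.1 * s : ℝ) : ℂ) * Complex.I)) *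
        Complex.exp (((matsubaraFreq β M q.1 * s : ℝ) : ℂ) * Complex.I) =
        Complex.exp (((2 * Real.pi * ((matsubaraInt M q.1 - matsubaraInt M k.1 : ℤ) : ℝ) * s / β : ℝ) : ℂ) * Complex.I) := by
      rw [← Complex.exp_add]
      congr 1
      simp only [matsubaraFreq]
      push_cast
      field_simp
      ring
    calc _ = (Complex.exp (-(((matsubaraFreq β M k.1 * s : ℝ) : ℂ) * Complex.I)) *
          Complex.exp (((matsubaraFreq β M q.1 * s : ℝ) : ℂ) * Complex.I)) * (torusChar q.2 x * conj (torusChar k.2 x)) := by ring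
      _ = _ := by rw [hph]
  simp_rw [hterm, ← Finset.mul_sum, sum_torusChar_right]
  rw [intervalIntegral.integral_mul_const, integral_exp_freqTransfer hβ]
  have hfreq : (matsubaraInt M q.1 - matsubaraInt M k.1 = 0) ↔ q.1 = k.1 := by
    constructor
    · intro h; simp only [matsubaraInt] at h; exact Fin.ext (by omega)
    · intro h; rw [h, sub_self]
  simp only [hfreq, sub_eq_zero]

/-- **THE TWO-POINT FOURIER STEP (F)** (`β ≠ 0`, every `U`, `L`, `M`, `σ`):
`N_M(k,σ) = βL² · ∫₀^β Σ_x e^{−iω_k s} conj χ_{k⃗}(x) · ∫dμ_C ψ⁺_{(x,s)σ}ψ⁻_{(0,0)σ}e^{−V} ds`. -/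
theorem twoPoint_eq_integral_position {β : ℝ} (hβ : β ≠ 0) (U μ : ℝ) (σ : Fin 2) (k : FreqMomentum L M) :
    gaussExpect ℂ (hubbardCovariance L M β μ 0)
        (gen ℂ (((k, σ), 0) : HubbardFieldIdx L M) * gen ℂ (((k, σ), 1) : HubbardFieldIdx L M) *
          grassmannExp (-(hubbardInteraction L M β U))) =
      ((β * (L : ℝ) ^ 2 : ℝ) : ℂ) *
        ∫ s in (0 : ℝ)..β, ∑ x : TorusSite 2 L,
          Complex.exp (-(((matsubaraFreq β M k.1 * s : ℝ) : ℂ) * Complex.I)) * conj (torusChar k.2 x) *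
            gaussExpect ℂ (hubbardCovariance L M β μ 0)
              (positionField L M β 0 σ x s * positionField L M β 1 σ 0 0 * grassmannExp (-(hubbardInteraction L M β U))) := by
  have hβL : ((β * (L : ℝ) ^ 2 : ℝ) : ℂ) ≠ 0 := by
    have hL : (L : ℝ) ≠ 0 := by exact_mod_cast NeZero.ne L
    exact_mod_cast mul_ne_zero hβ (pow_ne_zero 2 hL)
  set N : FreqMomentum L M → ℂ := fun q => gaussExpect ℂ (hubbardCovariance L M β μ 0)
    (gen ℂ (((q, σ), 0) : HubbardFieldIdx L M) * gen ℂ (((q, σ), 1) : HubbardFieldIdx L M) *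
      grassmannExp (-(hubbardInteraction L M β U))) with hN
  set r₁ : ℂ := (((1 / (β * (L : ℝ) ^ 2) : ℝ) : ℂ)) with hr₁
  rw [show (fun s : ℝ => ∑ x : TorusSite 2 L,
      Complex.exp (-(((matsubaraFreq β M k.1 * s : ℝ) : ℂ) * Complex.I)) * conj (torusChar k.2 x) *
        gaussExpect ℂ (hubbardCovariance L M β μ 0)
          (positionField L M β 0 σ x s * positionField L M β 1 σ 0 0 * grassmannExp (-(hubbardInteraction L M β U)))) =
      fun s : ℝ => ∑ x : TorusSite 2 L,
        Complex.exp (-(((matsubaraFreq β M k.1 * s : ℝ) : ℂ) * Complex.I)) * conj (torusChar k.2 x) *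
          ∑ q : FreqMomentum L M, ((r₁ * conj (vertexPlaneWave L M β 0 q x s)) * r₁) * N q from by
    funext s
    simp only [positionTwoPoint_eq_sum, hr₁, hN]]
  -- the integrand as a label sum
  have hint : ∀ s : ℝ, (∑ x : TorusSite 2 L,
      Complex.exp (-(((matsubaraFreq β M k.1 * s : ℝ) : ℂ) * Complex.I)) * conj (torusChar k.2 x) *
        ∑ q : FreqMomentum L M, ((r₁ * conj (vertexPlaneWave L M β 0 q x s)) * r₁) * N q) =
      ∑ q : FreqMomentum L M, (∑ x : TorusSite 2 L,
        Complex.exp (-(((matsubaraFreq β M k.1 * s : ℝ) : ℂ) * Complex.I)) * conj (torusChar k.2 x) * conj (vertexPlaneWave L M β 0 q x s)) *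
          (r₁ * r₁ * N q) := by
    intro s
    simp_rw [Finset.mul_sum]
    rw [Finset.sum_comm]
    refine Finset.sum_congr rfl fun q _ => ?_
    rw [Finset.sum_mul]
    refine Finset.sum_congr rfl fun x _ => ?_
    ring
  simp_rw [hint]
  have hcont : ∀ q : FreqMomentum L M, Continuous fun s : ℝ => (∑ x : TorusSite 2 L,
      Complex.exp (-(((matsubaraFreq β M k.1 * s : ℝ) : ℂ) * Complex.I)) * conj (torusChar k.2 x) * conj (vertexPlaneWave L M β 0 q x s)) *
        (r₁ * r₁ * N q) := by
    intro q
    refine (continuous_finsetSum _ fun x _ => ?_).mul continuous_const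
    have h0 := continuous_conj_vertexPlaneWave_time (L := L) (M := M) β 0 q x
    have he : Continuous fun s : ℝ => Complex.exp (-(((matsubaraFreq β M k.1 * s : ℝ) : ℂ) * Complex.I)) := by fun_prop
    exact (he.mul continuous_const).mul h0
  rw [intervalIntegral.integral_finsetSum fun q _ => (hcont q).intervalIntegrable _ _]
  simp_rw [intervalIntegral.integral_mul_const, integral_sum_phase_pair hβ]
  rw [Finset.mul_sum, Finset.sum_eq_single k]
  · rw [if_pos rfl, if_pos rfl, hr₁]
    have hL : (L : ℂ) ≠ 0 := by exact_mod_cast NeZero.ne L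
    have hβ' : (β : ℂ) ≠ 0 := by exact_mod_cast hβ
    simp only [hN]
    push_cast
    field_simp
  · intro q _ hq
    have : (if q.1 = k.1 then (β : ℂ) else 0) * (if q.2 = k.2 then ((L : ℂ) ^ 2) else 0) = 0 := by
      by_cases h1 : q.1 = k.1
      · have h2 : q.2 ≠ k.2 := fun h2 => hq (Prod.ext h1 h2)
        rw [if_neg h2, mul_zero]
      · rw [if_neg h1, zero_mul]
    rw [this]; ring
  · intro h; exact absurd (Finset.mem_univ _) h

/-! ## §2 Per-label convergence of the carrier from the L¹ limit of the position two-point numerator -/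

/-- The τ-resolved position two-point numerator is continuous in the time (a trigonometric polynomial). -/
theorem continuous_positionTwoPoint (β U μ : ℝ) (σ : Fin 2) (x : TorusSite 2 L) :
    Continuous fun s : ℝ => gaussExpect ℂ (hubbardCovariance L M β μ 0)
      (positionField L M β 0 σ x s * positionField L M β 1 σ 0 0 * grassmannExp (-(hubbardInteraction L M β U))) := by
  simp_rw [positionTwoPoint_eq_sum]
  refine continuous_finsetSum _ fun q _ => ?_
  exact ((continuous_const.mul (continuous_conj_vertexPlaneWave_time (L := L) (M := M) β 0 q x)).mul continuous_const).mul
    continuous_const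

/-- **PER-LABEL CONVERGENCE OF THE BARE CARRIER** (`β > 0`, any `U`, `σ`, fixed `L`): if the τ-resolved position two-point numerators
`P_M(x,·)` converge in `L¹([0,β])` to `Pinf x` for every site and `D_M → Dinf ≠ 0`, then along the labels `ω` with `matsubaraInt M ω = n`
the carrier converges to `σinf n p := (Iinf n p / Dinf + ĝ)/ĝ²`, `Iinf n p = ∫₀^β Σ_x e^{−iω_n s} conj χ_p(x) Pinf x s ds`, `ĝ = 1/(−iω_n + ξ_p)`. -/
theorem klSelfEnergy_bare_label_limit {β : ℝ} (hβ : 0 < β) (U μ : ℝ) (σ : Fin 2)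
    (Pinf : TorusSite 2 L → ℝ → ℂ) (hPi : ∀ x, IntervalIntegrable (Pinf x) volume 0 β) (Dinf : ℂ) (hDinf : Dinf ≠ 0)
    (hD : Tendsto (fun M : ℕ => effPartitionFn ℂ (hubbardCovariance L M β μ 0) (hubbardInteraction L M β U)) atTop (𝓝 Dinf))
    (hP : ∀ x : TorusSite 2 L, Tendsto (fun M : ℕ => ∫ s in (0 : ℝ)..β,
      ‖gaussExpect ℂ (hubbardCovariance L M β μ 0)
          (positionField L M β 0 σ x s * positionField L M β 1 σ 0 0 * grassmannExp (-(hubbardInteraction L M β U))) - Pinf x s‖)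
        atTop (𝓝 0))
    (n : ℤ) (p : TorusSite 2 L) (ε : ℝ) (hε : 0 < ε) :
    ∃ M₁ : ℕ, ∀ M : ℕ, M₁ ≤ M → ∀ ω : MatsubaraIdx M, matsubaraInt M ω = n →
      ‖klSelfEnergy L M β U μ 0 klE0 (nScales β + 1) (ω, p) σ -
        ((∫ s in (0 : ℝ)..β, ∑ x : TorusSite 2 L,
            Complex.exp (-(((Real.pi * (2 * (n : ℝ) + 1) / β * s : ℝ) : ℂ) * Complex.I)) * conj (torusChar p x) * Pinf x s) / Dinf +
          1 / (-Complex.I * ((Real.pi * (2 * (n : ℝ) + 1) / β : ℝ) : ℂ) + (nambuXiCT L μ 0 p : ℂ))) /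
          (1 / (-Complex.I * ((Real.pi * (2 * (n : ℝ) + 1) / β : ℝ) : ℂ) + (nambuXiCT L μ 0 p : ℂ))) ^ 2‖ ≤ ε := by
  have hDpos : 0 < ‖Dinf‖ := norm_pos_iff.mpr hDinf
  have hβL : ((β * (L : ℝ) ^ 2 : ℝ) : ℂ) ≠ 0 := by
    have hL : (L : ℝ) ≠ 0 := by exact_mod_cast NeZero.ne L
    exact_mod_cast mul_ne_zero hβ.ne' (pow_ne_zero 2 hL)
  -- the fixed free propagator at this label
  set g : ℂ := 1 / (-Complex.I * ((Real.pi * (2 * (n : ℝ) + 1) / β : ℝ) : ℂ) + (nambuXiCT L μ 0 p : ℂ)) with hg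
  have hgω : ∀ (M : ℕ) (ω : MatsubaraIdx M), matsubaraInt M ω = n → propCT L M β μ 0 (ω, p) = g := by
    intro M ω hω
    rw [propCT, hg, matsubaraFreq, hω]
  have hg0 : g ≠ 0 := by
    rw [hg, one_div]
    refine inv_ne_zero fun h => ?_
    have hodd : (Real.pi * (2 * (n : ℝ) + 1) / β) ≠ 0 := by
      rw [div_ne_zero_iff]; refine ⟨mul_ne_zero Real.pi_pos.ne' ?_, hβ.ne'⟩
      have h2 : ((2 * n + 1 : ℤ) : ℝ) ≠ 0 := by exact_mod_cast (show (2 * n + 1 : ℤ) ≠ 0 by omega)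
      push_cast at h2
      exact h2
    have him : (-Complex.I * ((Real.pi * (2 * (n : ℝ) + 1) / β : ℝ) : ℂ) + (nambuXiCT L μ 0 p : ℂ)).im =
        -(Real.pi * (2 * (n : ℝ) + 1) / β) := by
      simp [Complex.mul_im, Complex.I_re, Complex.I_im, Complex.ofReal_im, Complex.ofReal_re]
    rw [h, Complex.zero_im] at him
    exact hodd (by linarith)
  -- the phases and the transforms
  set ψ : TorusSite 2 L → ℝ → ℂ := fun x s =>
    Complex.exp (-(((Real.pi * (2 * (n : ℝ) + 1) / β * s : ℝ) : ℂ) * Complex.I)) * conj (torusChar p x) with hψ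
  have hψnorm : ∀ x s, ‖ψ x s‖ = 1 := fun x s => by
    rw [hψ]; dsimp only
    rw [norm_mul, ← neg_mul, ← Complex.ofReal_neg, Complex.norm_exp_ofReal_mul_I, Complex.norm_conj, norm_torusChar, one_mul]
  have hψc : ∀ x, Continuous (ψ x) := fun x => by rw [hψ]; fun_prop
  set PM : (M : ℕ) → TorusSite 2 L → ℝ → ℂ := fun M x s => gaussExpect ℂ (hubbardCovariance L M β μ 0)
    (positionField L M β 0 σ x s * positionField L M β 1 σ 0 0 * grassmannExp (-(hubbardInteraction L M β U))) with hPM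
  have hPMc : ∀ M x, Continuous (PM M x) := fun M x => continuous_positionTwoPoint (L := L) (M := M) β U μ σ x
  set Iinf : ℂ := ∫ s in (0 : ℝ)..β, ∑ x : TorusSite 2 L, ψ x s * Pinf x s with hIinf
  set Ainf : ℝ := ∫ s in (0 : ℝ)..β, ∑ x : TorusSite 2 L, ‖Pinf x s‖ with hAinf
  have hAint : IntervalIntegrable (fun s => ∑ x : TorusSite 2 L, ‖Pinf x s‖) volume 0 β := by
    have h := IntervalIntegrable.sum (Finset.univ : Finset (TorusSite 2 L)) fun x _ => (hPi x).norm
    simpa only [Finset.sum_fn] using h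
  have hIinf_le : ‖Iinf‖ ≤ Ainf := by
    rw [hIinf]
    refine intervalIntegral.norm_integral_le_of_norm_le hβ.le (Filter.Eventually.of_forall fun s _ => ?_) hAint
    exact (norm_sum_le _ _).trans (Finset.sum_le_sum fun x _ => by rw [norm_mul, hψnorm, one_mul])
  set δ : ℕ → ℝ := fun M => ∑ x : TorusSite 2 L, ∫ s in (0 : ℝ)..β, ‖PM M x s - Pinf x s‖ with hδ
  have hδ_t : Tendsto δ atTop (𝓝 0) := by
    have := tendsto_finsetSum (Finset.univ : Finset (TorusSite 2 L)) fun x _ => hP x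
    simpa using this
  -- transform comparison at cutoff M for labels of integer n
  have hcmp : ∀ (M : ℕ) (ω : MatsubaraIdx M), matsubaraInt M ω = n →
      ‖(∫ s in (0 : ℝ)..β, ∑ x : TorusSite 2 L,
          Complex.exp (-(((matsubaraFreq β M ω * s : ℝ) : ℂ) * Complex.I)) * conj (torusChar p x) * PM M x s) - Iinf‖ ≤ δ M := by
    intro M ω hω
    have hφψ : (fun s => ∑ x : TorusSite 2 L,
        Complex.exp (-(((matsubaraFreq β M ω * s : ℝ) : ℂ) * Complex.I)) * conj (torusChar p x) * PM M x s) =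
        fun s => ∑ x : TorusSite 2 L, ψ x s * PM M x s := by
      funext s; rw [hψ]; simp only [matsubaraFreq, hω]
    rw [hφψ, hIinf]
    have hint1 : IntervalIntegrable (fun s => ∑ x : TorusSite 2 L, ψ x s * PM M x s) volume 0 β :=
      (continuous_finsetSum _ fun x _ => (hψc x).mul (hPMc M x)).intervalIntegrable _ _
    have hint2 : IntervalIntegrable (fun s => ∑ x : TorusSite 2 L, ψ x s * Pinf x s) volume 0 β := by
      have h := IntervalIntegrable.sum (Finset.univ : Finset (TorusSite 2 L)) fun x _ => ((hPi x).continuousOn_mul (hψc x).continuousOn)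
      simpa only [Finset.sum_fn] using h
    have hgi : IntervalIntegrable (fun s => ∑ x : TorusSite 2 L, ‖PM M x s - Pinf x s‖) volume 0 β := by
      have h := IntervalIntegrable.sum (Finset.univ : Finset (TorusSite 2 L)) fun x _ =>
        (((hPMc M x).intervalIntegrable (0 : ℝ) β).sub (hPi x)).norm
      simpa only [Finset.sum_fn] using h
    rw [← intervalIntegral.integral_sub hint1 hint2]
    refine (intervalIntegral.norm_integral_le_of_norm_le hβ.le (Filter.Eventually.of_forall fun s _ => ?_) hgi).trans ?_
    · rw [← Finset.sum_sub_distrib]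
      refine (norm_sum_le _ _).trans (Finset.sum_le_sum fun x _ => ?_)
      rw [← mul_sub, norm_mul, hψnorm, one_mul]
    · rw [intervalIntegral.integral_finsetSum fun x _ => (((hPMc M x).intervalIntegrable _ _).sub (hPi x)).norm]
  -- the real majorant sequence for `IM/D − Iinf/Dinf`, divided by `|g|²`
  set η : ℕ → ℝ := fun M => (δ M * (2 / ‖Dinf‖) +
      Ainf * ‖(effPartitionFn ℂ (hubbardCovariance L M β μ 0) (hubbardInteraction L M β U))⁻¹ - Dinf⁻¹‖) / ‖g‖ ^ 2 with hη
  have hη_t : Tendsto η atTop (𝓝 0) := by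
    have h2 : Tendsto (fun M => ‖(effPartitionFn ℂ (hubbardCovariance L M β μ 0) (hubbardInteraction L M β U))⁻¹ - Dinf⁻¹‖)
        atTop (𝓝 0) := by
      have := ((hD.inv₀ hDinf).sub_const Dinf⁻¹).norm
      simpa using this
    have : Tendsto η atTop (𝓝 ((0 * (2 / ‖Dinf‖) + Ainf * 0) / ‖g‖ ^ 2)) :=
      ((hδ_t.mul_const _).add (h2.const_mul _)).div_const _
    simpa using this
  have hDev : ∀ᶠ M : ℕ in atTop, ‖Dinf‖ / 2 ≤ ‖effPartitionFn ℂ (hubbardCovariance L M β μ 0) (hubbardInteraction L M β U)‖ := by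
    have h := hD.eventually (Metric.ball_mem_nhds Dinf (half_pos hDpos))
    filter_upwards [h] with M hM
    rw [dist_eq_norm] at hM
    have := norm_sub_norm_le Dinf (effPartitionFn ℂ (hubbardCovariance L M β μ 0) (hubbardInteraction L M β U))
    rw [← norm_neg, neg_sub] at hM
    linarith
  obtain ⟨M₁, hM₁⟩ := Filter.eventually_atTop.mp (hDev.and (hη_t.eventually (gt_mem_nhds hε)))
  refine ⟨M₁, fun M hM ω hω => ?_⟩
  obtain ⟨hDM, hηM⟩ := hM₁ M hM
  set D : ℂ := effPartitionFn ℂ (hubbardCovariance L M β μ 0) (hubbardInteraction L M β U) with hDdef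
  have hDne : D ≠ 0 := by intro h; rw [h, norm_zero] at hDM; linarith
  have hDn : 0 < ‖D‖ := norm_pos_iff.mpr hDne
  -- the carrier at this label
  rw [klSelfEnergy_nScales_succ_eq_selfEnergy_fullActionCT hβ, selfEnergy_fullActionCT_eq_bare_ratio hβ.ne' U μ 0 (ω, p) σ hDne,
    twoPoint_eq_integral_position hβ.ne' U μ σ (ω, p), hgω M ω hω]
  set IM : ℂ := ∫ s in (0 : ℝ)..β, ∑ x : TorusSite 2 L,
    Complex.exp (-(((matsubaraFreq β M ω * s : ℝ) : ℂ) * Complex.I)) * conj (torusChar p x) * PM M x s with hIM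
  have h1 : ‖IM - Iinf‖ ≤ δ M := hcmp M ω hω
  have hcancel : (((β * (L : ℝ) ^ 2 : ℝ) : ℂ) * IM / D + ((β * (L : ℝ) ^ 2 : ℝ) : ℂ) * g) / (((β * (L : ℝ) ^ 2 : ℝ) : ℂ) * g ^ 2) =
      (IM / D + g) / g ^ 2 := by
    rw [show ((β * (L : ℝ) ^ 2 : ℝ) : ℂ) * IM / D + ((β * (L : ℝ) ^ 2 : ℝ) : ℂ) * g = ((β * (L : ℝ) ^ 2 : ℝ) : ℂ) * (IM / D + g) by ring,
      mul_div_mul_left _ _ hβL]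
  have hsplit : (IM / D + g) / g ^ 2 - (Iinf / Dinf + g) / g ^ 2 = ((IM - Iinf) * D⁻¹ + Iinf * (D⁻¹ - Dinf⁻¹)) / g ^ 2 := by
    field_simp
    ring
  show ‖(((β * (L : ℝ) ^ 2 : ℝ) : ℂ) * IM / D + ((β * (L : ℝ) ^ 2 : ℝ) : ℂ) * g) / (((β * (L : ℝ) ^ 2 : ℝ) : ℂ) * g ^ 2) -
      (Iinf / Dinf + g) / g ^ 2‖ ≤ ε
  rw [hcancel, hsplit, norm_div, norm_pow]
  refine le_trans ?_ hηM.le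
  rw [hη]
  refine div_le_div_of_nonneg_right ((norm_add_le _ _).trans (add_le_add ?_ ?_)) (by positivity)
  · rw [norm_mul, norm_inv]
    refine mul_le_mul h1 ?_ (inv_nonneg.mpr (norm_nonneg _)) ((norm_nonneg _).trans h1)
    rw [inv_eq_one_div, div_le_div_iff₀ hDn hDpos]
    linarith
  · rw [norm_mul]
    exact mul_le_mul_of_nonneg_right hIinf_le (norm_nonneg _)

/-! ## §3 The registered stub from pointwise limits and ONE pointwise identification -/

/-- **`stub_vl_bound` FROM POINTWISE LIMITS.**  For every `β > 0`, `U`, `μ`, `L ≥ 3` suppose: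
(P6) pointwise-in-`u ∈ [0,β)` limits and an eventual sup bound on `[0,β]` of the word six-point numerator `∫dμ_{C_M}e^{−V}·sixPointWord L M β 0 1 z u`;
(P2) the same for the τ-resolved position two-point numerator `P_M(x,s) = ∫dμ_{C_M}ψ⁺_{(x,s)↑}ψ⁻_{(0,0)↑}e^{−V}` with limit `Pinf x s`;
(B2) the `L`-UNIFORM bound `‖(Iinf n p / D∞ + ĝ)/ĝ²‖ ≤ BH β U μ` of the resulting limit carrier, `D∞ = e^{−βUL²/4}Z_U/Z₀` (t2's limit of the bare
normalised partition functions), `Iinf n p = ∫₀^βΣ_x e^{−iω_n s}conj χ_p(x)Pinf x s ds`, `ĝ = 1/(−iω_n + ξ_p)` — i.e. k3c5-p2's Hamiltonian bound once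
`Pinf/D∞` is identified with the thermal τ-two-point function.  Then the registered `stub_vl_bound` text holds verbatim. -/
theorem stub_vl_bound_of_pointwise_limits (BH : ℝ → ℝ → ℝ → ℝ)
    (hZ : ∀ β : ℝ, 0 < β → ∀ (U μ : ℝ) (L : ℕ) [NeZero L], 3 ≤ L →
      (∃ (Sinf : TorusSite 2 L → ℝ → ℂ) (C : ℝ),
        (∀ z : TorusSite 2 L, ∀ u ∈ Set.Ico (0 : ℝ) β, Tendsto (fun M : ℕ =>
          gaussExpect ℂ (hubbardCovariance L M β μ 0) (grassmannExp (-(hubbardInteraction L M β U)) * sixPointWord L M β 0 1 z u))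
            atTop (𝓝 (Sinf z u))) ∧
        (∀ᶠ M : ℕ in atTop, ∀ (z : TorusSite 2 L), ∀ u ∈ Set.Icc (0 : ℝ) β,
          ‖gaussExpect ℂ (hubbardCovariance L M β μ 0) (grassmannExp (-(hubbardInteraction L M β U)) * sixPointWord L M β 0 1 z u)‖ ≤ C)) ∧
      (∃ (Pinf : TorusSite 2 L → ℝ → ℂ) (C₂ : ℝ),
        (∀ x : TorusSite 2 L, ∀ s ∈ Set.Ico (0 : ℝ) β, Tendsto (fun M : ℕ =>
          gaussExpect ℂ (hubbardCovariance L M β μ 0)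
            (positionField L M β 0 0 x s * positionField L M β 1 0 0 0 * grassmannExp (-(hubbardInteraction L M β U))))
            atTop (𝓝 (Pinf x s))) ∧
        (∀ᶠ M : ℕ in atTop, ∀ (x : TorusSite 2 L), ∀ s ∈ Set.Icc (0 : ℝ) β,
          ‖gaussExpect ℂ (hubbardCovariance L M β μ 0)
            (positionField L M β 0 0 x s * positionField L M β 1 0 0 0 * grassmannExp (-(hubbardInteraction L M β U)))‖ ≤ C₂) ∧
        (∀ (n : ℤ) (p : TorusSite 2 L),
          ‖((∫ s in (0 : ℝ)..β, ∑ x : TorusSite 2 L,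
              Complex.exp (-(((Real.pi * (2 * (n : ℝ) + 1) / β * s : ℝ) : ℂ) * Complex.I)) * conj (torusChar p x) * Pinf x s) /
              (((Real.exp (-(β * U / 4 * (L : ℝ) ^ 2)) : ℝ) : ℂ) * Matrix.partitionFn β (hubbardTorusWith 2 L 1 U (μ + U / 2)) /
                Matrix.partitionFn β (hubbardTorusWith 2 L 1 0 μ)) +
            1 / (-Complex.I * ((Real.pi * (2 * (n : ℝ) + 1) / β : ℝ) : ℂ) + (nambuXiCT L μ 0 p : ℂ))) /
            (1 / (-Complex.I * ((Real.pi * (2 * (n : ℝ) + 1) / β : ℝ) : ℂ) + (nambuXiCT L μ 0 p : ℂ))) ^ 2‖ ≤ BH β U μ))) :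
    ∀ (G : GeoConsts) (P : SplitConsts) (Q : EngConsts) (R : RenConsts), G.WF → P.WF → Q.WF → R.WF →
      ∃ c₅ : ℝ, 0 < c₅ ∧ ∀ c : ℝ, 0 < c → c ≤ c₅ → ∃ U₀ : ℝ, 0 < U₀ ∧
        ∀ μ ∈ klWindowC, ∀ U : ℝ, 0 < U → U ≤ U₀ → ∀ β : ℝ, klBetaMin ≤ β → β ≤ Real.exp (c / U ^ 2) →
          ∀ K : TrigPolyC4v, klPredsV12.frameOK R U (nScales β) μ K →
            ∀ (Lstar : ℕ) (Mstar : ℕ → ℕ), TowerP klPredsV12 G P Q R β U μ K Lstar Mstar →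
              ∃ B : ℝ, ∃ L₀ : ℕ, ∃ Mth : ℕ → ℕ, ∀ (L : ℕ) [NeZero L], L₀ ≤ L → ∀ (M : ℕ) [NeZero M], Mth L ≤ M →
                ∀ (k : FreqMomentum L M) (σ : Fin 2), ‖klSelfEnergy L M β U μ K klE0 (nScales β + 1) k σ‖ ≤ B := by
  refine stub_vl_bound_of_pointwise_twoPoint BH fun β hβ U μ L _ hL => ?_
  obtain ⟨h6, Pinf, C₂, hpt, hbd, hB2⟩ := hZ β hβ U μ L hL
  refine ⟨h6, fun n p => ⟨_, hB2 n p, ?_⟩⟩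
  -- the partition-function limit, explicit
  haveI : Nonempty (Finset (Orb (FermionTorus 2 L))) := ⟨∅⟩
  have hZ' : Matrix.partitionFn β (hubbardTorusWith 2 L 1 U (μ + U / 2)) ≠ 0 :=
    (Matrix.partitionFn_pos β (isHermitian_hamiltonianWith (fermionTorusGraph 2 L) 1 U (μ + U / 2))).ne'
  have hZ₀ : Matrix.partitionFn β (hubbardTorusWith 2 L 1 0 μ) ≠ 0 :=
    (Matrix.partitionFn_pos β (isHermitian_hamiltonianWith (fermionTorusGraph 2 L) 1 0 μ)).ne'
  have he : ((Real.exp (-(β * U / 4 * (L : ℝ) ^ 2)) : ℝ) : ℂ) ≠ 0 := by exact_mod_cast (Real.exp_pos _).ne'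
  have hDinf : ((Real.exp (-(β * U / 4 * (L : ℝ) ^ 2)) : ℝ) : ℂ) * Matrix.partitionFn β (hubbardTorusWith 2 L 1 U (μ + U / 2)) /
      Matrix.partitionFn β (hubbardTorusWith 2 L 1 0 μ) ≠ 0 := div_ne_zero (mul_ne_zero he hZ') hZ₀
  have hD := MatsubaraAllU.tendsto_effPartitionFn_hubbard_eq_partitionFn_div_allU hL hβ μ U
  -- L¹ convergence of the position two-point numerator by dominated convergence
  have hx : ∀ x : TorusSite 2 L, IntervalIntegrable (Pinf x) volume 0 β ∧
      Tendsto (fun M : ℕ => ∫ s in (0 : ℝ)..β, ‖gaussExpect ℂ (hubbardCovariance L M β μ 0)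
        (positionField L M β 0 0 x s * positionField L M β 1 0 0 0 * grassmannExp (-(hubbardInteraction L M β U))) - Pinf x s‖)
        atTop (𝓝 0) := fun x =>
    l1_tendsto_of_pointwise_dominated hβ (fun M s => gaussExpect ℂ (hubbardCovariance L M β μ 0)
        (positionField L M β 0 0 x s * positionField L M β 1 0 0 0 * grassmannExp (-(hubbardInteraction L M β U)))) (Pinf x)
      (fun M => continuous_positionTwoPoint (L := L) (M := M) β U μ 0 x) (hpt x) (hbd.mono fun M hM => hM x)
  intro ε hε
  exact klSelfEnergy_bare_label_limit hβ U μ 0 Pinf (fun x => (hx x).1) _ hDinf hD (fun x => (hx x).2) n p ε hε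

end Summit.HubbardSuperconductivity.HubbardSuperconductivity.Theorems.TwoPointAssembly

end
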